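import Mathlib
import Literature.Analysis.FluidPDE.ClassicalSolution
import Literature.Analysis.FluidPDE.LerayHopf
import Literature.Analysis.FluidPDE.NSWave0
import Literature.Analysis.FluidPDE.VectorCalculus
import Summits.NavierStokesRegularity.NavierStokesRegularity.Theorems.SlicedKelvinPlanarFluxAPrioriEpsilonLimit
import Summits.NavierStokesRegularity.NavierStokesRegularity.Theorems.SlicedKelvinPlanarFluxAPrioriFoliation
import Summits.NavierStokesRegularity.NavierStokesRegularity.Theorems.SlicedKelvinPlanarFluxAPrioriHeatDuality

/-!
# Crux `SlicedKelvin.PlanarFluxAPriori` (stmt-NavierStokesRegularity-15600), line `registered`: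
  `stub_heatKernelDomination` REDUCED to the ε-fold-law subsolution package (closed glue)

The registered stub `stub_heatKernelDomination` of the skeleton `Cruxes/PlanarFluxAPriori/Lines/birth.lean`
(heat-kernel domination of the unsigned planar vorticity flux by the initial sup-over-heights flux plus
`C ·` the Duhamel fold-creation functional) is proved here FROM ONE EXPLICIT HYPOTHESIS, the
**ε-fold-law subsolution package** `FoldLawSubsolution` (spelled out verbatim in the statement): along every
classical Leray–Hopf solution on `[0,T)` from a rapidly decaying datum, for every `t ∈ (0,T)`, every
`ε ∈ (0,1)` and every frame `R`, the regularised planar flux profile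
`φ(τ,c) = ∫ (√(f² + ε²) − ε)`, `f = ⟪curl u(τ), R e₂⟫` on the plane `R{x₂ = c}`, is a bounded classical
subsolution of `∂_τ − ν∂_c²` on `[0,t] × ℝ` (jointly continuous, `φₜ, ∂_cφ, ∂_c²φ` bounded, `φₜ, ∂_c²φ`
jointly continuous) with source `S(τ,c) = ∫_{plane} (s_ε)⁺`, `s_ε` the stub's ε-regularised fold-creation
density, and the regularised density is integrable on the planes at time `t`. That package is exactly what
the route's support item `FoldLawEps` (stmt-15606: the kinematic ε-fold law, transport + stretching
cancelling on the plane), the vorticity equation (curl of the momentum equation, `curl_gradient_eq_zero`),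
differentiation under the plane integral, and the persistence of polynomial (order-3, three derivatives)
spatial decay of the solution to positive times must deliver; none of it is assumed proved here.

Given the package, the stub follows from the landed helpers: the 1-D heat DUALITY bound
`heat_subsolution_duhamel_bound_iSup` (`…HeatDuality`) with `C = (4π)^{-1/2}`, the Bochner-to-`lintegral`
passages (`ofReal_integral_eq_lintegral_ofReal` on the left, `ofReal_integral_le_lintegral_ofReal'` for the
initial profile and the source), Fubini over the foliation `lintegral_lintegral_foliation` (`…Foliation`:
`∫ dc ∫_{plane} s_ε⁺ = ∫_{ℝ³} s_ε⁺`, the integrand being Borel measurable for every field), and the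
`ε → 0⁺` reduction `planarFlux_le_of_forall_eps` (`…EpsilonLimit`); the slice `t = 0` is `le_iSup`.

* `stub_heatKernelDomination_of_foldLawSubsolution : FoldLawSubsolution → <stub_heatKernelDomination>`
  (both sides verbatim; sorry-free).
-/

noncomputable section

-- Problem = summit for this single-conjunct summit: the duplicate namespace component is deliberate.
set_option linter.dupNamespace false

namespace Summit.NavierStokesRegularity.NavierStokesRegularity.Theorems.SlicedKelvinPlanarFluxAPriori

open MeasureTheory Set Filter
open scoped ENNReal NNReal Topology
open Literature.Analysis.FluidPDE

/-- `ofReal (max a 0) = ofReal a`. -/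
theorem ofReal_max_zero (a : ℝ) : ENNReal.ofReal (max a 0) = ENNReal.ofReal a := by
  rcases le_total a 0 with h | h
  · rw [max_eq_right h, ENNReal.ofReal_zero, ENNReal.ofReal_of_nonpos h]
  · rw [max_eq_left h]

/-- The stub's ε-regularised fold-creation density of a CONTINUOUS field is Borel measurable in `x`
(every `fderiv · x v` is measurable in `x`, Mathlib `measurable_fderiv_apply_const`; the curl of any field
is measurable, `measurable_curl'`). -/
theorem measurable_foldDensity : ∀ (v : EuclideanSpace ℝ (Fin 3) → EuclideanSpace ℝ (Fin 3)), Continuous v → ∀ (R : EuclideanSpace ℝ (Fin 3) ≃ₗᵢ[ℝ] EuclideanSpace ℝ (Fin 3)) (ε : ℝ), Measurable fun x : EuclideanSpace ℝ (Fin 3) => -(inner ℝ (v x) (R (EuclideanSpace.single 2 1))) * (ε ^ 2 / Real.sqrt (inner ℝ (Literature.Analysis.FluidPDE.curl v x) (R (EuclideanSpace.single 2 1)) ^ 2 + ε ^ 2) ^ 3) * (inner ℝ (Literature.Analysis.FluidPDE.curl v x) (R (EuclideanSpace.single 0 1)) * fderiv ℝ (fun z => inner ℝ (Literature.Analysis.FluidPDE.curl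 v z) (R (EuclideanSpace.single 2 1))) x (R (EuclideanSpace.single 0 1)) + inner ℝ (Literature.Analysis.FluidPDE.curl v x) (R (EuclideanSpace.single 1 1)) * fderiv ℝ (fun z => inner ℝ (Literature.Analysis.FluidPDE.curl v z) (R (EuclideanSpace.single 2 1))) x (R (EuclideanSpace.single 1 1))) - ε ^ 2 * fderiv ℝ (fun z => inner ℝ (v z) (R (EuclideanSpace.single 2 1))) x (R (EuclideanSpace.single 2 1)) / Real.sqrt (inner ℝ (Literature.Analysis.FluidPDE.curl v x) (R (EuclideanSpace.single 2 1)) ^ 2 + ε ^ 2) := by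
  intro v hv R ε
  have hc : Measurable (curl v) := measurable_curl' v
  have h0 : Measurable fun x => inner ℝ (curl v x) (R (EuclideanSpace.single 0 1)) := hc.inner_const
  have h1 : Measurable fun x => inner ℝ (curl v x) (R (EuclideanSpace.single 1 1)) := hc.inner_const
  have h2 : Measurable fun x => inner ℝ (curl v x) (R (EuclideanSpace.single 2 1)) := hc.inner_const
  have hu : Measurable fun x => inner ℝ (v x) (R (EuclideanSpace.single 2 1)) := hv.measurable.inner_const
  have hd0 : Measurable fun x => fderiv ℝ (fun z => inner ℝ (curl v z) (R (EuclideanSpace.single 2 1))) x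
      (R (EuclideanSpace.single 0 1)) := measurable_fderiv_apply_const ℝ _ _
  have hd1 : Measurable fun x => fderiv ℝ (fun z => inner ℝ (curl v z) (R (EuclideanSpace.single 2 1))) x
      (R (EuclideanSpace.single 1 1)) := measurable_fderiv_apply_const ℝ _ _
  have hd2 : Measurable fun x => fderiv ℝ (fun z => inner ℝ (v z) (R (EuclideanSpace.single 2 1))) x
      (R (EuclideanSpace.single 2 1)) := measurable_fderiv_apply_const ℝ _ _
  have hF : Measurable fun x => Real.sqrt (inner ℝ (curl v x) (R (EuclideanSpace.single 2 1)) ^ 2 + ε ^ 2) :=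
    ((h2.pow_const 2).add_const _).sqrt
  exact ((hu.neg.mul ((hF.pow_const 3).const_div _)).mul ((h0.mul hd0).add (h1.mul hd1))).sub
    ((hd2.const_mul _).div hF)

/-- **`stub_heatKernelDomination` from the ε-fold-law subsolution package.** See the module docstring:
the hypothesis is the package (a bounded classical heat subsolution in the height, with source the plane
integral of the positive part of the stub's fold-creation density, plus integrability of the regularised
density on the planes at time `t`), the conclusion is the registered stub verbatim. -/
theorem stub_heatKernelDomination_of_foldLawSubsolution : (∀ (ν T : ℝ), 0 < ν → 0 < T → ∀ (u : ℝ → EuclideanSpace ℝ (Fin 3) → EuclideanSpace ℝ (Fin 3)) (p : ℝ → EuclideanSpace ℝ (Fin 3) → ℝ), Literature.Analysis.FluidPDE.IsClassicalNSSolutionOn (Set.Ico 0 T) ν 0 u p → Literature.Analysis.FluidPDE.IsLerayHopfOn T ν 0 (u 0) u → Literature.Analysis.FluidPDE.HasRapidSpatialDecay (u 0) → ∀ t ∈ Set.Ioo 0 T, ∀ ε ∈ Set.Ioo (0 : ℝ) 1, ∀ (R : EuclideanSpace ℝ (Fin 3) ≃ₗᵢ[ℝ] EuclideanSpace ℝ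 (Fin 3)), ∃ (φ S φₜ φ₁ φ₂ : ℝ → ℝ → ℝ) (B : ℝ), (∀ τ c, φ τ c = ∫ y : EuclideanSpace ℝ (Fin 2), (Real.sqrt (inner ℝ (Literature.Analysis.FluidPDE.curl (u τ) (R (WithLp.toLp 2 ![y 0, y 1, c]))) (R (EuclideanSpace.single 2 1)) ^ 2 + ε ^ 2) - ε)) ∧ (∀ τ c, S τ c = ∫ y : EuclideanSpace ℝ (Fin 2), max (-(inner ℝ (u τ (R (WithLp.toLp 2 ![y 0, y 1, c]))) (R (EuclideanSpace.single 2 1))) * (ε ^ 2 / Real.sqrt (inner ℝ (Literature.Analysis.FluidPDE.curl (u τ) (R (WithLp.toLp 2 ![y 0, y 1, c]))) (R (EuclideanSpace.single 2 1)) ^ 2 + ε ^ 2) ^ 3) * (inner ℝ (Literature.Analysis.FluidPDE.curl (u τ) (R (WithLp.toLp 2 ![y 0, y 1, c]))) (R (EuclideanSpace.single 0 1)) * fderiv ℝ (fun z => inner ℝ (Literature.Analysis.FluidPDE.curl (u τ) z) (R (EuclideanSpace.single 2 1))) (R (WithLp.toLp 2 ![y 0, y 1, c])) (R (EuclideanSpace.single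 0 1)) + inner ℝ (Literature.Analysis.FluidPDE.curl (u τ) (R (WithLp.toLp 2 ![y 0, y 1, c]))) (R (EuclideanSpace.single 1 1)) * fderiv ℝ (fun z => inner ℝ (Literature.Analysis.FluidPDE.curl (u τ) z) (R (EuclideanSpace.single 2 1))) (R (WithLp.toLp 2 ![y 0, y 1, c])) (R (EuclideanSpace.single 1 1))) - ε ^ 2 * fderiv ℝ (fun z => inner ℝ (u τ z) (R (EuclideanSpace.single 2 1))) (R (WithLp.toLp 2 ![y 0, y 1, c])) (R (EuclideanSpace.single 2 1)) / Real.sqrt (inner ℝ (Literature.Analysis.FluidPDE.curl (u τ) (R (WithLp.toLp 2 ![y 0, y 1, c]))) (R (EuclideanSpace.single 2 1)) ^ 2 + ε ^ 2)) 0) ∧ ContinuousOn (Function.uncurry φ) (Set.Icc 0 t ×ˢ Set.univ) ∧ ContinuousOn (Function.uncurry φₜ) (Set.Ioo 0 t ×ˢ Set.univ) ∧ ContinuousOn (Function.uncurry φ₂) (Set.Ioo 0 t ×ˢ Set.univ) ∧ (∀ τ ∈ Set.Ioo 0 t, ∀ c, HasDerivAt (fun σ => φ σ c) (φₜ τ c)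 τ) ∧ (∀ τ ∈ Set.Ioo 0 t, ∀ c, HasDerivAt (φ τ) (φ₁ τ c) c) ∧ (∀ τ ∈ Set.Ioo 0 t, ∀ c, HasDerivAt (φ₁ τ) (φ₂ τ c) c) ∧ (∀ τ ∈ Set.Icc 0 t, ∀ c, |φ τ c| ≤ B) ∧ (∀ τ ∈ Set.Ioo 0 t, ∀ c, |φₜ τ c| ≤ B) ∧ (∀ τ ∈ Set.Ioo 0 t, ∀ c, |φ₁ τ c| ≤ B) ∧ (∀ τ ∈ Set.Ioo 0 t, ∀ c, |φ₂ τ c| ≤ B) ∧ (∀ τ ∈ Set.Ioo 0 t, ∀ c, φₜ τ c - ν * φ₂ τ c ≤ S τ c) ∧ (∀ c, MeasureTheory.Integrable (fun y : EuclideanSpace ℝ (Fin 2) => Real.sqrt (inner ℝ (Literature.Analysis.FluidPDE.curl (u t) (R (WithLp.toLp 2 ![y 0, y 1, c]))) (R (EuclideanSpace.single 2 1)) ^ 2 + ε ^ 2) - ε))) → ∃ C : NNReal, ∀ (ν T : ℝ), 0 < ν → 0 < T → ∀ (u : ℝ → EuclideanSpace ℝ (Fin 3) → EuclideanSpace ℝ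 (Fin 3)) (p : ℝ → EuclideanSpace ℝ (Fin 3) → ℝ), Literature.Analysis.FluidPDE.IsClassicalNSSolutionOn (Set.Ico 0 T) ν 0 u p → Literature.Analysis.FluidPDE.IsLerayHopfOn T ν 0 (u 0) u → Literature.Analysis.FluidPDE.HasRapidSpatialDecay (u 0) → ∀ t ∈ Set.Ico 0 T, ∀ (R : EuclideanSpace ℝ (Fin 3) ≃ₗᵢ[ℝ] EuclideanSpace ℝ (Fin 3)) (c : ℝ), ∫⁻ y : EuclideanSpace ℝ (Fin 2), ‖inner ℝ (Literature.Analysis.FluidPDE.curl (u t) (R (WithLp.toLp 2 ![y 0, y 1, c]))) (R (EuclideanSpace.single 2 1))‖ₑ ≤ (⨆ c' : ℝ, ∫⁻ y : EuclideanSpace ℝ (Fin 2), ‖inner ℝ (Literature.Analysis.FluidPDE.curl (u 0) (R (WithLp.toLp 2 ![y 0, y 1, c']))) (R (EuclideanSpace.single 2 1))‖ₑ) + (C : ENNReal) * Filter.liminf (fun ε : ℝ => ∫⁻ τ in Set.Ioo 0 t, ENNReal.ofReal (1 / Real.sqrt (ν * (t - τ))) * (∫⁻ x : EuclideanSpace ℝ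 (Fin 3), ENNReal.ofReal (-(inner ℝ (u τ x) (R (EuclideanSpace.single 2 1))) * (ε ^ 2 / Real.sqrt (inner ℝ (Literature.Analysis.FluidPDE.curl (u τ) x) (R (EuclideanSpace.single 2 1)) ^ 2 + ε ^ 2) ^ 3) * (inner ℝ (Literature.Analysis.FluidPDE.curl (u τ) x) (R (EuclideanSpace.single 0 1)) * fderiv ℝ (fun z => inner ℝ (Literature.Analysis.FluidPDE.curl (u τ) z) (R (EuclideanSpace.single 2 1))) x (R (EuclideanSpace.single 0 1)) + inner ℝ (Literature.Analysis.FluidPDE.curl (u τ) x) (R (EuclideanSpace.single 1 1)) * fderiv ℝ (fun z => inner ℝ (Literature.Analysis.FluidPDE.curl (u τ) z) (R (EuclideanSpace.single 2 1))) x (R (EuclideanSpace.single 1 1))) - ε ^ 2 * fderiv ℝ (fun z => inner ℝ (u τ z) (R (EuclideanSpace.single 2 1))) x (R (EuclideanSpace.single 2 1)) / Real.sqrt (inner ℝ (Literature.Analysis.FluidPDE.curl (u τ) x) (R (EuclideanSpace.single 2 1)) ^ 2 + ε ^ 2)))) (nhdsWithin 0 (Set.Ioi 0)) := by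
  intro hFL
  refine ⟨(1 / Real.sqrt (4 * Real.pi)).toNNReal, ?_⟩
  intro ν T hν hT u p hcl hLH hdec t ht R c
  rcases eq_or_lt_of_le ht.1 with h0 | htpos
  · -- the initial slice: `Φ(0;R,c) ≤ ⨆_{c'} Φ(0;R,c')`
    subst h0
    exact le_add_right (le_iSup (fun c' : ℝ => ∫⁻ y : EuclideanSpace ℝ (Fin 2), ‖inner ℝ
      (Literature.Analysis.FluidPDE.curl (u 0) (R (WithLp.toLp 2 ![y 0, y 1, c'])))
      (R (EuclideanSpace.single 2 1))‖ₑ) c)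
  · have htT : t ∈ Set.Ioo 0 T := ⟨htpos, ht.2⟩
    refine planarFlux_le_of_forall_eps u t R c _ _ 1 one_pos fun ε hε => ?_
    obtain ⟨φ, S, φₜ, φ₁, φ₂, B, hφ, hS, hcont, hcont_t, hcont_2, hdt, hd1, hd2, hB, hBt, hB1, hB2,
      hsub, hint⟩ := hFL ν T hν hT u p hcl hLH hdec t htT ε hε R
    have key := heat_subsolution_duhamel_bound_iSup (S := S) hν htpos hcont hcont_t hcont_2 hdt hd1 hd2
      hB hBt hB1 hB2 hsub c
    -- (a) the left-hand side is `ofReal (φ t c)`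
    have ea : ∫⁻ y : EuclideanSpace ℝ (Fin 2), ENNReal.ofReal (Real.sqrt (inner ℝ (Literature.Analysis.FluidPDE.curl (u t) (R (WithLp.toLp 2 ![y 0, y 1, c]))) (R (EuclideanSpace.single 2 1)) ^ 2 + ε ^ 2) - ε) = ENNReal.ofReal (φ t c) := by
      rw [hφ t c, ofReal_integral_eq_lintegral_ofReal (hint c)
        (ae_of_all _ fun y => sqrt_sq_add_sq_sub_nonneg _ hε.1.le)]
    -- (b) the initial profile
    have eb : (⨆ c' : ℝ, ENNReal.ofReal (φ 0 c')) ≤ ⨆ c' : ℝ, ∫⁻ y : EuclideanSpace ℝ (Fin 2),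
        ENNReal.ofReal (Real.sqrt (inner ℝ (Literature.Analysis.FluidPDE.curl (u 0) (R (WithLp.toLp 2 ![y 0, y 1, c']))) (R (EuclideanSpace.single 2 1)) ^ 2 + ε ^ 2) - ε) := by
      refine iSup_mono fun c' => ?_
      rw [hφ 0 c']
      exact Literature.Analysis.FunctionSpaces.ofReal_integral_le_lintegral_ofReal' _
    -- (c) the source: plane integrals of `s_ε⁺`, integrated over the height, are the bulk integral
    have ed : ∀ τ ∈ Set.Ioo 0 t, ∫⁻ c' : ℝ, ENNReal.ofReal (S τ c') ≤
        ∫⁻ x : EuclideanSpace ℝ (Fin 3), ENNReal.ofReal (-(inner ℝ (u τ x) (R (EuclideanSpace.single 2 1))) * (ε ^ 2 / Real.sqrt (inner ℝ (Literature.Analysis.FluidPDE.curl (u τ) x) (R (EuclideanSpace.single 2 1)) ^ 2 + ε ^ 2) ^ 3) * (inner ℝ (Literature.Analysis.FluidPDE.curl (u τ) x) (R (EuclideanSpace.single 0 1)) * fderiv ℝ (fun z => inner ℝ (Literature.Analysis.FluidPDE.curl (u τ) z) (R (EuclideanSpace.single 2 1))) x (R (EuclideanSpace.single 0 1)) + inner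 ℝ (Literature.Analysis.FluidPDE.curl (u τ) x) (R (EuclideanSpace.single 1 1)) * fderiv ℝ (fun z => inner ℝ (Literature.Analysis.FluidPDE.curl (u τ) z) (R (EuclideanSpace.single 2 1))) x (R (EuclideanSpace.single 1 1))) - ε ^ 2 * fderiv ℝ (fun z => inner ℝ (u τ z) (R (EuclideanSpace.single 2 1))) x (R (EuclideanSpace.single 2 1)) / Real.sqrt (inner ℝ (Literature.Analysis.FluidPDE.curl (u τ) x) (R (EuclideanSpace.single 2 1)) ^ 2 + ε ^ 2)) := by
      intro τ hτ
      have hτT : τ ∈ Set.Ico 0 T := ⟨hτ.1.le, hτ.2.trans ht.2⟩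
      have hmeas := (measurable_foldDensity (u τ) (hcl.contDiff_velocity hτT).continuous R ε).ennreal_ofReal
      calc ∫⁻ c' : ℝ, ENNReal.ofReal (S τ c')
          ≤ ∫⁻ c' : ℝ, ∫⁻ y : EuclideanSpace ℝ (Fin 2), ENNReal.ofReal (-(inner ℝ (u τ (R (WithLp.toLp 2 ![y 0, y 1, c']))) (R (EuclideanSpace.single 2 1))) * (ε ^ 2 / Real.sqrt (inner ℝ (Literature.Analysis.FluidPDE.curl (u τ) (R (WithLp.toLp 2 ![y 0, y 1, c']))) (R (EuclideanSpace.single 2 1)) ^ 2 + ε ^ 2) ^ 3) * (inner ℝ (Literature.Analysis.FluidPDE.curl (u τ) (R (WithLp.toLp 2 ![y 0, y 1, c']))) (R (EuclideanSpace.single 0 1)) * fderiv ℝ (fun z => inner ℝ (Literature.Analysis.FluidPDE.curl (u τ) z) (R (EuclideanSpace.single 2 1))) (R (WithLp.toLp 2 ![y 0, y 1, c'])) (R (EuclideanSpace.single 0 1)) + inner ℝ (Literature.Analysis.FluidPDE.curl (u τ) (R (WithLp.toLp 2 ![y 0, y 1, c']))) (R (EuclideanSpace.single 1 1)) * fderiv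 ℝ (fun z => inner ℝ (Literature.Analysis.FluidPDE.curl (u τ) z) (R (EuclideanSpace.single 2 1))) (R (WithLp.toLp 2 ![y 0, y 1, c'])) (R (EuclideanSpace.single 1 1))) - ε ^ 2 * fderiv ℝ (fun z => inner ℝ (u τ z) (R (EuclideanSpace.single 2 1))) (R (WithLp.toLp 2 ![y 0, y 1, c'])) (R (EuclideanSpace.single 2 1)) / Real.sqrt (inner ℝ (Literature.Analysis.FluidPDE.curl (u τ) (R (WithLp.toLp 2 ![y 0, y 1, c']))) (R (EuclideanSpace.single 2 1)) ^ 2 + ε ^ 2)) := by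
            refine lintegral_mono fun c' => ?_
            rw [hS τ c']
            refine (Literature.Analysis.FunctionSpaces.ofReal_integral_le_lintegral_ofReal' _).trans ?_
            exact lintegral_mono fun y => (ofReal_max_zero _).le
        _ = ∫⁻ x : EuclideanSpace ℝ (Fin 3), ENNReal.ofReal (-(inner ℝ (u τ x) (R (EuclideanSpace.single 2 1))) * (ε ^ 2 / Real.sqrt (inner ℝ (Literature.Analysis.FluidPDE.curl (u τ) x) (R (EuclideanSpace.single 2 1)) ^ 2 + ε ^ 2) ^ 3) * (inner ℝ (Literature.Analysis.FluidPDE.curl (u τ) x) (R (EuclideanSpace.single 0 1)) * fderiv ℝ (fun z => inner ℝ (Literature.Analysis.FluidPDE.curl (u τ) z) (R (EuclideanSpace.single 2 1))) x (R (EuclideanSpace.single 0 1)) + inner ℝ (Literature.Analysis.FluidPDE.curl (u τ) x) (R (EuclideanSpace.single 1 1)) * fderiv ℝ (fun z => inner ℝ (Literature.Analysis.FluidPDE.curl (u τ) z) (R (EuclideanSpace.single 2 1))) x (R (EuclideanSpace.single 1 1))) - ε ^ 2 * fderiv ℝ (fun z => inner ℝ (u τ z) (R (EuclideanSpace.single 2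 1))) x (R (EuclideanSpace.single 2 1)) / Real.sqrt (inner ℝ (Literature.Analysis.FluidPDE.curl (u τ) x) (R (EuclideanSpace.single 2 1)) ^ 2 + ε ^ 2)) :=
            lintegral_lintegral_foliation R _ hmeas
    -- assemble
    rw [ea]
    refine key.trans (add_le_add eb ?_)
    refine mul_le_mul' le_rfl (setLIntegral_mono' measurableSet_Ioo fun τ hτ => ?_)
    exact mul_le_mul' le_rfl (ed τ hτ)

end Summit.NavierStokesRegularity.NavierStokesRegularity.Theorems.SlicedKelvinPlanarFluxAPriori

end
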